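import Literature.AnabelianGeometry.EtaleTheta.Discharge.Sec5EnvAut

/-!
# [EtTh] §5, Theorem 5.10 (ii) discharged modulo its cited inputs (pp. 333–335 / PDF pp. 107–109)

Mochizuki, *The étale theta function …*, Publ. RIMS **45** (2009)
[cite: MochizukiEtTh2009, Thm 5.10 (ii) p.333 (PDF p.107)].  Seat abc-iut-L2-d4 (wave-3 discharge of node
`EtTh:Thm5.10(ii)`); PROOF-ONLY, over abc-iut-L2-t4's `FrobenioidMonoTheta.lean` (`PsiAutPreserves`,
`psiAut`) and `FrobenioidThetaBiKummer.lean` (`SgpCapSpec`, `SgpCupSpec`, `OKxRootN`, `KxRootN`).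

Theorem 5.10 (ii) (pp.333–334 (PDF pp.107–108)): "`Ψ^Aut`, `Ψ^birat_Aut` preserve `O^×(B_N)`; `(O_K^×)^{1/N} ⊆ O^×(B_N)`;
`O^×(B_N^birat)`; `(K^×)^{1/N} ⊆ O^×(B_N^birat)` and map the data `E_N`; `Im(s^⊓-gp_N)`; `Im(s^⊔-gp_N)` to data
`δ₁ · E_N · δ₁⁻¹`; `δ₁ · Im(s^⊓-gp_N) · δ₁⁻¹`; `δ₁ · δ₂ · δ₃ · Im(s^⊔-gp_N) · δ₃⁻¹ · δ₂⁻¹ · δ₁⁻¹` for some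
`δ₁ ∈ O^×(B_N)`, some `δ₂ ∈ μ_{2l·N}(B_N) ∩ (O_K^×)^{1/N}`, and some `δ₃ ∈ s^⊓-gp_N(Aut_D(B_N^bs))`."  The printed
proof (pp.334–335 (PDF pp.108–109)) cites: (a) "the existence of `Ψ^bs`" (Thm. 4.4 (i): a 1-compatible self-equivalence of
`D`) ⇒ `Ψ` preserves `O^×(−)` — here `units_map_psiAut` from a natural isomorphism
`Ψ ⋙ Base ≅ Base ⋙ Ψ^bs` with `Ψ^bs` faithful; (b) Prop. 3.4 (ii) (`K^× ⊆ O^×(B_N^birat)` as the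
`Aut_C(B_N)`-invariants) ⇒ `Ψ^birat_Aut` preserves `K^×` — the hypothesis `hconst`, whence `(K^×)^{1/N}`,
`(O_K^×)^{1/N}` (`KxRootN_map`, `OKxRootN_map_psiAut`); (c) "`Ψ` preserves `N`-th roots of fraction-pairs
[Thm. 4.4 (ii)], together with the corresponding bi-Kummer `N`-th roots [Thm. 4.4 (iv)], for … `l`-th roots of
the theta function [up to the indeterminacies of Thm. 5.7]" — here the ROOT-TRANSPORT hypotheses: isomorphisms
`α : Ψ(A_N) ≅ A_N` (Thm. 5.10 (i)), `e ∈ Aut_C(A_N)`, `D, D' ∈ Aut_C(B_N)` with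
`α⁻¹ ≫ Ψ(s^⊓_N) ≫ β = e ≫ s^⊓_N ≫ D`, `α⁻¹ ≫ Ψ(s^⊔_N) ≫ β = e ≫ s^⊔_N ≫ D'` (Prop. 4.2 (iv): two `N`-th roots of
[translates of] the same fraction-pair are isomorphic), `D⁻¹ · D' ∈ (μ_{2l·N}(B_N) ∩ (O_K^×)^{1/N}) · Im(s^⊓-gp_N)`
(Thm. 5.7: "up to possible multiplication by a `2l`-th root of unity and possible translation by an element
of … `l·ℤ`"), and the transport of the base-Frobenius section `s^trv_N` through `e` over an automorphism `θ`
of `Aut_D(B_N^bs)` preserving `Im(Π^tp_Y̲)`, `H_{B_N}` ([FrdI] Prop. 5.6; Prop. 2.4).  From these, the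
conjugation formulae FOLLOW by the uniqueness of the bi-Kummer homomorphisms (abc-iut-L2-t4's PROVED `SgpUnique`
route: the defining relations `SgpCapSpec`/`SgpCupSpec` and `Epi s^⊓_N, s^⊔_N`): `psiAut_sgpCap`,
`psiAut_sgpCup`, and the packaging `psiAutPreserves_of`.  HONEST FRAMING: a kernel-checked implication between
typed statements about the §5 data; nothing here asserts a result of [EtTh] unconditionally; typed ≠ discharged;
no side taken on anything downstream. -/

namespace Literature.AnabelianGeometry.EtaleTheta

open CategoryTheory
open scoped Pointwise

universe w v v' u u'

namespace ThetaFrobenioid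

variable {C : Type u} [Category.{v} C] {D : Type u'} [Category.{v'} D] {𝔉 : ThetaFrobenioid.{w} C D}
variable (Ψ : C ≌ C) (β : Ψ.functor.obj 𝔉.BN ≅ 𝔉.BN)

/-! ### `Ψ^Aut` on morphisms -/

/-- `Ψ^Aut(x) = β⁻¹ ≫ Ψ(x) ≫ β` on underlying morphisms. [cite: MochizukiEtTh2009, Thm 5.10 (ii) p.333 (PDF p.107)] -/
theorem psiAut_hom (x : Aut 𝔉.BN) :
    (𝔉.psiAut Ψ β x).hom = β.inv ≫ Ψ.functor.map x.hom ≫ β.hom := by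
  change (β.conjAut (Ψ.functor.mapIso x)).hom = _
  rw [Iso.conjAut_hom, Iso.conj_apply, CategoryTheory.Functor.mapIso_hom]

/-! ### (a) `Ψ^Aut` preserves `O^×(B_N)` — from a 1-compatible `Ψ^bs` (Thm. 4.4 (i)) -/

/-- Conjugation by an isomorphism `β : X ≅ Y` carries units to units (`(β⁻¹ ≫ u ≫ β)^bs = (β^bs)⁻¹ ≫ 1 ≫ β^bs`).
[cite: MochizukiEtTh2009, Thm 5.10 (ii) p.334 (PDF p.108)] -/
theorem conjAut_mem_units {X Y : C} (β : X ≅ Y) {u : Aut X} (hu : u ∈ 𝔉.units X) :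
    β.conjAut u ∈ 𝔉.units Y := by
  rw [𝔉.units_eq_ker, MonoidHom.mem_ker] at hu ⊢
  apply Aut.ext
  have hb : 𝔉.base.map u.hom = 𝟙 _ := congrArg Iso.hom hu
  change 𝔉.base.map (β.conjAut u).hom = 𝟙 _
  rw [Iso.conjAut_hom, Iso.conj_apply, CategoryTheory.Functor.map_comp, CategoryTheory.Functor.map_comp,
    hb, Category.id_comp, ← CategoryTheory.Functor.map_comp, Iso.inv_hom_id, CategoryTheory.Functor.map_id]

/-- **`Ψ^Aut` preserves `O^×(B_N)`** (first clause of Thm. 5.10 (ii)), from a faithful 1-compatible `Ψ^bs`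
(`units_map_mapAut`) and conjugation by `β`.  [cite: MochizukiEtTh2009, Thm 5.10 (ii) p.334 (PDF p.108)] -/
theorem units_map_psiAut (Ψbs : D ⥤ D) [Ψbs.Faithful] (eΨ : Ψ.functor ⋙ 𝔉.base ≅ 𝔉.base ⋙ Ψbs) :
    (𝔉.units 𝔉.BN).map (𝔉.psiAut Ψ β) = 𝔉.units 𝔉.BN := by
  have hU := units_map_mapAut Ψ Ψbs eΨ 𝔉.BN
  rw [show 𝔉.psiAut Ψ β = β.conjAut.toMonoidHom.comp (Ψ.functor.mapAut 𝔉.BN) from rfl,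
    ← Subgroup.map_map, hU]
  ext x
  constructor
  · rintro ⟨u, hu, rfl⟩
    exact conjAut_mem_units β hu
  · intro hx
    refine ⟨β.symm.conjAut x, conjAut_mem_units β.symm hx, ?_⟩
    change β.conjAut (β.symm.conjAut x) = x
    exact Aut.ext (by rw [Iso.conjAut_hom, Iso.conjAut_hom, Iso.self_symm_conj])

/-! ### (b) the constants — from Prop. 3.4 (ii) (`hconst`) and the birational square (`hsq`) -/

/-- `Ψ^birat_Aut((K^×)^{1/N}) = (K^×)^{1/N}` from `Ψ^birat_Aut(K^×) = K^×`.
[cite: MochizukiEtTh2009, Thm 5.10 (ii) p.334 (PDF p.108)] -/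
theorem KxRootN_map (ΨbiratAut : 𝔉.biratUnits 𝔉.BN ≃* 𝔉.biratUnits 𝔉.BN)
    (hconst : 𝔉.constEmb.range.map ΨbiratAut.toMonoidHom = 𝔉.constEmb.range) :
    𝔉.KxRootN.map ΨbiratAut.toMonoidHom = 𝔉.KxRootN := by
  refine map_equiv_eq_of_mem_iff fun f => ?_
  rw [mem_KxRootN, mem_KxRootN, ← map_pow, mem_iff_of_map_equiv_eq hconst]

/-- `Ψ^Aut((O_K^×)^{1/N}) = (O_K^×)^{1/N}` from the preservation of `O^×(B_N)`, `(K^×)^{1/N}` and the square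
`O^×(B_N) ↪ O^×(B_N^birat)`.  [cite: MochizukiEtTh2009, Thm 5.10 (ii) p.334 (PDF p.108)] -/
theorem OKxRootN_map_psiAut (ΨbiratAut : 𝔉.biratUnits 𝔉.BN ≃* 𝔉.biratUnits 𝔉.BN)
    (hU : (𝔉.units 𝔉.BN).map (𝔉.psiAut Ψ β) = 𝔉.units 𝔉.BN)
    (hsq : ∀ u : 𝔉.units 𝔉.BN, ∀ hu : 𝔉.psiAut Ψ β u ∈ 𝔉.units 𝔉.BN,
      ΨbiratAut (𝔉.unitsToBirat 𝔉.BN u) = 𝔉.unitsToBirat 𝔉.BN ⟨_, hu⟩)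
    (hK : 𝔉.KxRootN.map ΨbiratAut.toMonoidHom = 𝔉.KxRootN) :
    𝔉.OKxRootN.map (𝔉.psiAut Ψ β) = 𝔉.OKxRootN := by
  rw [← psiAutEquiv_toMonoidHom] at hU ⊢
  have hmem : ∀ x : Aut 𝔉.BN, x ∈ 𝔉.OKxRootN ↔
      ∃ hx : x ∈ 𝔉.units 𝔉.BN, 𝔉.unitsToBirat 𝔉.BN ⟨x, hx⟩ ∈ 𝔉.KxRootN := by
    intro x
    constructor
    · rintro ⟨u, hu, rfl⟩
      exact ⟨u.2, hu⟩
    · rintro ⟨hx, hk⟩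
      exact ⟨⟨x, hx⟩, hk, rfl⟩
  refine map_equiv_eq_of_mem_iff fun x => ⟨fun hx => ?_, fun hx => ?_⟩
  · obtain ⟨hxu', hk'⟩ := (hmem _).mp hx
    have hxu : x ∈ 𝔉.units 𝔉.BN := (mem_iff_of_map_equiv_eq hU x).mp hxu'
    refine (hmem x).mpr ⟨hxu, ?_⟩
    have hx2 := hsq ⟨x, hxu⟩ hxu'
    rw [← mem_iff_of_map_equiv_eq hK, hx2]
    exact hk'
  · obtain ⟨hxu, hk⟩ := (hmem x).mp hx
    have hΨx : 𝔉.psiAut Ψ β x ∈ 𝔉.units 𝔉.BN := (mem_iff_of_map_equiv_eq hU x).mpr hxu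
    refine (hmem _).mpr ⟨hΨx, ?_⟩
    have hx2 := hsq ⟨x, hxu⟩ hΨx
    change 𝔉.unitsToBirat 𝔉.BN ⟨𝔉.psiAut Ψ β x, hΨx⟩ ∈ 𝔉.KxRootN
    rw [← hx2]
    exact (mem_iff_of_map_equiv_eq hK _).mpr hk

/-! ### (c) the conjugation formulae — root transport + `SgpCapSpec`/`SgpCupSpec` + `Epi` -/

section RootTransport

variable (α : Ψ.functor.obj 𝔉.AN ≅ 𝔉.AN) (e : 𝔉.AN ≅ 𝔉.AN)

/-- **Uniqueness ⇒ equivariance.**  If `Ψ` transports the pre-step `s : A_N → B_N` to `e ≫ s ≫ D`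
(`α⁻¹ ≫ Ψ(s) ≫ β = e ≫ s ≫ D`: an isomorphism of `N`-th roots, Prop. 4.2 (iv), composed with the given
`α, β`) and transports `y ∈ Aut_C(A_N)` through `e` to `y'`, then for the "unique group homomorphism"
values `x, x'` over `y, y'` ("`s^⊓-gp_N(g) ∘ s^⊓_N = s^⊓_N ∘ s^trv_N(g)`", p.331 (PDF p.105)) one has
`Ψ^Aut(x) · D = D · x'` — since `s` is an epimorphism ([FrdI] Def. 1.3: totally epimorphic).
[cite: MochizukiEtTh2009, Thm 5.10 (ii) p.334 (PDF p.108)] -/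
theorem psiAut_mul_eq_of_transport {s : 𝔉.AN ⟶ 𝔉.BN} [Epi s] (Dm : Aut 𝔉.BN)
    (hT : α.inv ≫ Ψ.functor.map s ≫ β.hom = e.hom ≫ s ≫ Dm.hom)
    {x x' : Aut 𝔉.BN} {y y' : Aut 𝔉.AN} (hx : s ≫ x.hom = y.hom ≫ s) (hx' : s ≫ x'.hom = y'.hom ≫ s)
    (hy : α.inv ≫ Ψ.functor.map y.hom ≫ α.hom ≫ e.hom = e.hom ≫ y'.hom) :
    𝔉.psiAut Ψ β x * Dm = Dm * x' := by
  apply Aut.ext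
  change Dm.hom ≫ (𝔉.psiAut Ψ β x).hom = x'.hom ≫ Dm.hom
  rw [← cancel_epi s, ← cancel_epi e.hom]
  calc e.hom ≫ s ≫ Dm.hom ≫ (𝔉.psiAut Ψ β x).hom
      = (e.hom ≫ s ≫ Dm.hom) ≫ β.inv ≫ Ψ.functor.map x.hom ≫ β.hom := by
        rw [psiAut_hom]; simp only [Category.assoc]
    _ = α.inv ≫ Ψ.functor.map (s ≫ x.hom) ≫ β.hom := by
        rw [← hT]; simp only [Category.assoc, Iso.hom_inv_id_assoc, CategoryTheory.Functor.map_comp]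
    _ = (α.inv ≫ Ψ.functor.map y.hom ≫ α.hom) ≫ (α.inv ≫ Ψ.functor.map s ≫ β.hom) := by
        rw [hx]; simp only [Category.assoc, Iso.hom_inv_id_assoc, CategoryTheory.Functor.map_comp]
    _ = (α.inv ≫ Ψ.functor.map y.hom ≫ α.hom ≫ e.hom) ≫ s ≫ Dm.hom := by
        rw [hT]; simp only [Category.assoc]
    _ = e.hom ≫ (y'.hom ≫ s) ≫ Dm.hom := by rw [hy]; simp only [Category.assoc]
    _ = e.hom ≫ s ≫ x'.hom ≫ Dm.hom := by rw [← hx']; simp only [Category.assoc]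

variable (Dc Dp : Aut 𝔉.BN) (θ : Aut (𝔉.base.obj 𝔉.BN) ≃* Aut (𝔉.base.obj 𝔉.BN))

/-- **`Ψ^Aut(s^⊓-gp_N(g)) = D · s^⊓-gp_N(θ g) · D⁻¹`**, from the transport of the root morphism `s^⊓_N`
(`hT`) and of the base-Frobenius section `s^trv_N` over `θ` (`hstrv`), by the defining relation
`SgpCapSpec` and `Epi s^⊓_N` ("`Ψ` preserves `N`-th roots of fraction-pairs … together with the corresponding
bi-Kummer `N`-th roots", p.334–335 (PDF pp.108–109)).  [cite: MochizukiEtTh2009, Thm 5.10 (ii) p.334 (PDF p.108)] -/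
theorem psiAut_sgpCap [Epi 𝔉.sCap] (hcap : 𝔉.SgpCapSpec)
    (hT : α.inv ≫ Ψ.functor.map 𝔉.sCap ≫ β.hom = e.hom ≫ 𝔉.sCap ≫ Dc.hom)
    (hstrv : ∀ g : Aut (𝔉.base.obj 𝔉.BN),
      α.inv ≫ Ψ.functor.map (𝔉.strv (𝔉.autBaseIsoAB.symm g)).hom ≫ α.hom ≫ e.hom =
        e.hom ≫ (𝔉.strv (𝔉.autBaseIsoAB.symm (θ g))).hom)
    (g : Aut (𝔉.base.obj 𝔉.BN)) :
    𝔉.psiAut Ψ β (𝔉.sgpCap g) = Dc * 𝔉.sgpCap (θ g) * Dc⁻¹ := by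
  rw [← psiAut_mul_eq_of_transport Ψ β α e Dc hT (hcap g) (hcap (θ g)) (hstrv g), mul_inv_cancel_right]

/-- **`Ψ^Aut(s^⊔-gp_N(h)) = D' · s^⊔-gp_N(θ h) · D'⁻¹`** for `h ∈ H_{B_N}`, likewise from the transport of
`s^⊔_N` (`hT'`), `SgpCupSpec`, `Epi s^⊔_N`, with `θ(H_{B_N}) = H_{B_N}` (Prop. 2.4).
[cite: MochizukiEtTh2009, Thm 5.10 (ii) p.334 (PDF p.108)] -/
theorem psiAut_sgpCup [Epi 𝔉.sCup] (hcup : 𝔉.SgpCupSpec)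
    (hT' : α.inv ≫ Ψ.functor.map 𝔉.sCup ≫ β.hom = e.hom ≫ 𝔉.sCup ≫ Dp.hom)
    (hstrv : ∀ g : Aut (𝔉.base.obj 𝔉.BN),
      α.inv ≫ Ψ.functor.map (𝔉.strv (𝔉.autBaseIsoAB.symm g)).hom ≫ α.hom ≫ e.hom =
        e.hom ≫ (𝔉.strv (𝔉.autBaseIsoAB.symm (θ g))).hom)
    (hYdd : 𝔉.HB.map θ.toMonoidHom = 𝔉.HB) (h : 𝔉.HB) :
    𝔉.psiAut Ψ β (𝔉.sgpCup h) =
      Dp * 𝔉.sgpCup ⟨θ h, (mem_iff_of_map_equiv_eq hYdd _).mpr h.2⟩ * Dp⁻¹ := by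
  exact eq_mul_inv_of_mul_eq (psiAut_mul_eq_of_transport Ψ β α e Dp hT' (hcup h)
    (hcup ⟨θ h, (mem_iff_of_map_equiv_eq hYdd _).mpr h.2⟩) (hstrv h))

/-- `Ψ^Aut(Im(s^⊓-gp_N)) = D · Im(s^⊓-gp_N) · D⁻¹`. [cite: MochizukiEtTh2009, Thm 5.10 (ii) p.334 (PDF p.108)] -/
theorem range_sgpCap_map_psiAut [Epi 𝔉.sCap] (hcap : 𝔉.SgpCapSpec)
    (hT : α.inv ≫ Ψ.functor.map 𝔉.sCap ≫ β.hom = e.hom ≫ 𝔉.sCap ≫ Dc.hom)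
    (hstrv : ∀ g : Aut (𝔉.base.obj 𝔉.BN),
      α.inv ≫ Ψ.functor.map (𝔉.strv (𝔉.autBaseIsoAB.symm g)).hom ≫ α.hom ≫ e.hom =
        e.hom ≫ (𝔉.strv (𝔉.autBaseIsoAB.symm (θ g))).hom) :
    𝔉.sgpCap.range.map (𝔉.psiAut Ψ β) = MulAut.conj Dc • 𝔉.sgpCap.range := by
  ext x
  rw [Subgroup.mem_smul_pointwise_iff_exists]
  constructor
  · rintro ⟨_, ⟨g, rfl⟩, rfl⟩
    exact ⟨𝔉.sgpCap (θ g), ⟨θ g, rfl⟩, by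
      rw [MulAut.smul_def, MulAut.conj_apply, psiAut_sgpCap Ψ β α e Dc θ hcap hT hstrv]⟩
  · rintro ⟨_, ⟨g, rfl⟩, rfl⟩
    refine ⟨𝔉.sgpCap (θ.symm g), ⟨_, rfl⟩, ?_⟩
    rw [psiAut_sgpCap Ψ β α e Dc θ hcap hT hstrv, MulEquiv.apply_symm_apply, MulAut.smul_def,
      MulAut.conj_apply]

/-- `Ψ^Aut(Im(s^⊔-gp_N)) = D' · Im(s^⊔-gp_N) · D'⁻¹`. [cite: MochizukiEtTh2009, Thm 5.10 (ii) p.334 (PDF p.108)] -/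
theorem range_sgpCup_map_psiAut [Epi 𝔉.sCup] (hcup : 𝔉.SgpCupSpec)
    (hT' : α.inv ≫ Ψ.functor.map 𝔉.sCup ≫ β.hom = e.hom ≫ 𝔉.sCup ≫ Dp.hom)
    (hstrv : ∀ g : Aut (𝔉.base.obj 𝔉.BN),
      α.inv ≫ Ψ.functor.map (𝔉.strv (𝔉.autBaseIsoAB.symm g)).hom ≫ α.hom ≫ e.hom =
        e.hom ≫ (𝔉.strv (𝔉.autBaseIsoAB.symm (θ g))).hom)
    (hYdd : 𝔉.HB.map θ.toMonoidHom = 𝔉.HB) :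
    𝔉.sgpCup.range.map (𝔉.psiAut Ψ β) = MulAut.conj Dp • 𝔉.sgpCup.range := by
  ext x
  rw [Subgroup.mem_smul_pointwise_iff_exists]
  constructor
  · rintro ⟨_, ⟨h, rfl⟩, rfl⟩
    refine ⟨𝔉.sgpCup ⟨θ h, (mem_iff_of_map_equiv_eq hYdd _).mpr h.2⟩, ⟨_, rfl⟩, ?_⟩
    rw [MulAut.smul_def, MulAut.conj_apply]
    exact (psiAut_sgpCup Ψ β α e Dp θ hcup hT' hstrv hYdd h).symm
  · rintro ⟨_, ⟨h, rfl⟩, rfl⟩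
    have hm : θ.symm h ∈ 𝔉.HB :=
      (mem_iff_of_map_equiv_eq (map_symm_eq_of_map_equiv_eq hYdd) _).mpr h.2
    refine ⟨𝔉.sgpCup ⟨θ.symm h, hm⟩, ⟨_, rfl⟩, ?_⟩
    rw [MulAut.smul_def, MulAut.conj_apply]
    refine (psiAut_sgpCup Ψ β α e Dp θ hcup hT' hstrv hYdd ⟨θ.symm h, hm⟩).trans ?_
    exact congrArg (fun t => Dp * 𝔉.sgpCup t * Dp⁻¹)
      (Subtype.ext (θ.apply_symm_apply (h : Aut (𝔉.base.obj 𝔉.BN))))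

/-- `Ψ^Aut(E_N) = D · E_N · D⁻¹`, with `θ(Im(Π^tp_Y̲)) = Im(Π^tp_Y̲)` (Prop. 2.4) and `Ψ^Aut(O^×(B_N)) = O^×(B_N)`
(so that `Ψ^Aut(μ_N(B_N)) = μ_N(B_N)`).  [cite: MochizukiEtTh2009, Thm 5.10 (ii) p.334 (PDF p.108)] -/
theorem EN_map_psiAut [Epi 𝔉.sCap] (hcap : 𝔉.SgpCapSpec)
    (hT : α.inv ≫ Ψ.functor.map 𝔉.sCap ≫ β.hom = e.hom ≫ 𝔉.sCap ≫ Dc.hom)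
    (hstrv : ∀ g : Aut (𝔉.base.obj 𝔉.BN),
      α.inv ≫ Ψ.functor.map (𝔉.strv (𝔉.autBaseIsoAB.symm g)).hom ≫ α.hom ≫ e.hom =
        e.hom ≫ (𝔉.strv (𝔉.autBaseIsoAB.symm (θ g))).hom)
    (hY : 𝔉.imPiY.map θ.toMonoidHom = 𝔉.imPiY)
    (hU : (𝔉.units 𝔉.BN).map (𝔉.psiAut Ψ β) = 𝔉.units 𝔉.BN) :
    𝔉.EN.map (𝔉.psiAut Ψ β) = MulAut.conj Dc • 𝔉.EN := by
  haveI := 𝔉.muTorsion_normal 𝔉.BN 𝔉.N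
  have hμ : (𝔉.muTorsion 𝔉.BN 𝔉.N).map (𝔉.psiAut Ψ β) = 𝔉.muTorsion 𝔉.BN 𝔉.N := by
    rw [← psiAutEquiv_toMonoidHom] at hU ⊢
    refine map_equiv_eq_of_mem_iff fun u => ?_
    rw [mem_muTorsion, mem_muTorsion, mem_iff_of_map_equiv_eq hU, ← map_pow,
      MulEquiv.map_eq_one_iff]
  have hs : (𝔉.imPiY.map 𝔉.sgpCap).map (𝔉.psiAut Ψ β) = MulAut.conj Dc • 𝔉.imPiY.map 𝔉.sgpCap := by
    ext x
    rw [Subgroup.mem_smul_pointwise_iff_exists]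
    constructor
    · rintro ⟨_, ⟨g, hg, rfl⟩, rfl⟩
      exact ⟨𝔉.sgpCap (θ g), ⟨θ g, (mem_iff_of_map_equiv_eq hY _).mpr hg, rfl⟩, by
        rw [MulAut.smul_def, MulAut.conj_apply, psiAut_sgpCap Ψ β α e Dc θ hcap hT hstrv]⟩
    · rintro ⟨_, ⟨g, hg, rfl⟩, rfl⟩
      refine ⟨𝔉.sgpCap (θ.symm g),
        ⟨_, (mem_iff_of_map_equiv_eq (map_symm_eq_of_map_equiv_eq hY) _).mpr hg, rfl⟩, ?_⟩
      rw [psiAut_sgpCap Ψ β α e Dc θ hcap hT hstrv, MulEquiv.apply_symm_apply, MulAut.smul_def,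
        MulAut.conj_apply]
  change (𝔉.imPiY.map 𝔉.sgpCap ⊔ 𝔉.muTorsion 𝔉.BN 𝔉.N).map (𝔉.psiAut Ψ β) =
    MulAut.conj Dc • (𝔉.imPiY.map 𝔉.sgpCap ⊔ 𝔉.muTorsion 𝔉.BN 𝔉.N)
  rw [Subgroup.map_sup, hs, hμ, Subgroup.smul_sup,
    Subgroup.Normal.conj_smul_eq_self Dc (𝔉.muTorsion 𝔉.BN 𝔉.N)]

end RootTransport

/-! ### Assembly: Theorem 5.10 (ii) as typed -/

/-- **[EtTh] Theorem 5.10 (ii), discharged modulo its cited inputs.**  Hypotheses, in the order of the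
printed proof (pp.334–335 (PDF pp.108–109)): (a) a faithful 1-compatible `Ψ^bs` (`Ψbs`, `eΨ`: Thm. 4.4 (i)); (b) the
birational square for `Ψ^birat_Aut` on `O^×(B_N)` (`hsq`: [FrdI] Prop. 4.4) and `Ψ^birat_Aut(K^×) = K^×`
(`hconst`: Prop. 3.4 (ii)); (c) the transport of the `N`-th root `(A_N, B_N, s^⊓_N, s^⊔_N)`:
`α⁻¹ ≫ Ψ(s^⊓_N) ≫ β = e ≫ s^⊓_N ≫ D`, `α⁻¹ ≫ Ψ(s^⊔_N) ≫ β = e ≫ s^⊔_N ≫ D'` (Prop. 4.2 (iv) with Thm. 4.4 (ii))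
with `D⁻¹ · D' ∈ (μ_{2l·N}(B_N) ∩ (O_K^×)^{1/N}) · Im(s^⊓-gp_N)` (Thm. 5.7's "`2l`-th root of unity" and
"translation by … `l·ℤ`"), of `s^trv_N` through `e` over an automorphism `θ` of `Aut_D(B_N^bs)`
(Thm. 4.4 (iv); [FrdI] Prop. 5.6) that preserves `Im(Π^tp_Y̲)` and `H_{B_N}` (Prop. 2.4); and the named
§5 inputs `SgpCapSpec`, `SgpCupSpec`, `Epi s^⊓_N, s^⊔_N` (abc-iut-L2-t4's `Facts`), `SgpCapSection`,
`OuterActionLZ`, `ConstantsEqNormalizer` (Lemma 5.9 (iii), Lemma 5.8).  Conclusion: abc-iut-L2-t4's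
`PsiAutPreserves Ψ β Ψ^birat_Aut` with `δ₁ ∈ O^×(B_N)`, `δ₂ ∈ μ_{2l·N}(B_N) ∩ (O_K^×)^{1/N}`, `δ₃ ∈ Im(s^⊓-gp_N)`.
[cite: MochizukiEtTh2009, Thm 5.10 (ii) p.333–335 (PDF pp.107–109)] -/
theorem psiAutPreserves_of [Epi 𝔉.sCap] [Epi 𝔉.sCup] (hcap : 𝔉.SgpCapSpec) (hcup : 𝔉.SgpCupSpec)
    (hsec : 𝔉.SgpCapSection) (h3 : 𝔉.OuterActionLZ) (h8 : 𝔉.ConstantsEqNormalizer)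
    (ΨbiratAut : 𝔉.biratUnits 𝔉.BN ≃* 𝔉.biratUnits 𝔉.BN)
    (Ψbs : D ⥤ D) [Ψbs.Faithful] (eΨ : Ψ.functor ⋙ 𝔉.base ≅ 𝔉.base ⋙ Ψbs)
    (hsq : ∀ u : 𝔉.units 𝔉.BN, ∀ hu : 𝔉.psiAut Ψ β u ∈ 𝔉.units 𝔉.BN,
      ΨbiratAut (𝔉.unitsToBirat 𝔉.BN u) = 𝔉.unitsToBirat 𝔉.BN ⟨_, hu⟩)
    (hconst : 𝔉.constEmb.range.map ΨbiratAut.toMonoidHom = 𝔉.constEmb.range)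
    (α : Ψ.functor.obj 𝔉.AN ≅ 𝔉.AN) (e : 𝔉.AN ≅ 𝔉.AN) (Dc Dp : Aut 𝔉.BN)
    (θ : Aut (𝔉.base.obj 𝔉.BN) ≃* Aut (𝔉.base.obj 𝔉.BN))
    (hT : α.inv ≫ Ψ.functor.map 𝔉.sCap ≫ β.hom = e.hom ≫ 𝔉.sCap ≫ Dc.hom)
    (hT' : α.inv ≫ Ψ.functor.map 𝔉.sCup ≫ β.hom = e.hom ≫ 𝔉.sCup ≫ Dp.hom)
    (hind : ∃ δ₂' ∈ 𝔉.muTorsion 𝔉.BN (2 * 𝔉.l * 𝔉.N) ⊓ 𝔉.OKxRootN, ∃ δ₃' ∈ 𝔉.sgpCap.range,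
      Dc⁻¹ * Dp = δ₂' * δ₃')
    (hstrv : ∀ g : Aut (𝔉.base.obj 𝔉.BN),
      α.inv ≫ Ψ.functor.map (𝔉.strv (𝔉.autBaseIsoAB.symm g)).hom ≫ α.hom ≫ e.hom =
        e.hom ≫ (𝔉.strv (𝔉.autBaseIsoAB.symm (θ g))).hom)
    (hY : 𝔉.imPiY.map θ.toMonoidHom = 𝔉.imPiY) (hYdd : 𝔉.HB.map θ.toMonoidHom = 𝔉.HB) :
    𝔉.PsiAutPreserves Ψ β ΨbiratAut := by
  have hU := units_map_psiAut Ψ β Ψbs eΨ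
  have hK := KxRootN_map ΨbiratAut hconst
  -- `D = δ₁ · σ` with `δ₁` a unit and `σ ∈ Im(s^⊓-gp_N)` normalising `E_N`
  set σ : Aut 𝔉.BN := 𝔉.sgpCap (𝔉.autBase 𝔉.BN Dc) with hσ
  set δ₁ : Aut 𝔉.BN := Dc * σ⁻¹ with hδ₁
  have hδ₁u : δ₁ ∈ 𝔉.units 𝔉.BN := by
    rw [𝔉.units_eq_ker, MonoidHom.mem_ker, hδ₁, map_mul, map_inv, hσ, hsec, mul_inv_cancel]
  have hσn : σ ∈ Subgroup.normalizer (𝔉.EN : Set (Aut 𝔉.BN)) := by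
    obtain ⟨z, hz⟩ := 𝔉.ρ_surjective (𝔉.autBase 𝔉.BN Dc)
    rw [hσ, ← hz]
    exact h3 ⟨z, Subgroup.mem_top z, rfl⟩
  have hσr : σ ∈ 𝔉.sgpCap.range := ⟨_, rfl⟩
  have hDc : Dc = δ₁ * σ := by rw [hδ₁, inv_mul_cancel_right]
  obtain ⟨δ₂', hδ₂', δ₃', hδ₃', hDD⟩ := hind
  refine ⟨hU, OKxRootN_map_psiAut Ψ β ΨbiratAut hU hsq hK, hsq, hK, δ₁, σ * δ₂' * σ⁻¹, σ * δ₃', hδ₁u,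
    ?_, mul_mem hσr hδ₃', ?_, ?_, ?_⟩
  · -- `σ δ₂' σ⁻¹ ∈ μ_{2lN}(B_N) ∩ (O_K^×)^{1/N}`
    haveI := 𝔉.muTorsion_normal 𝔉.BN (2 * 𝔉.l * 𝔉.N)
    refine Subgroup.mem_inf.mpr ⟨(𝔉.muTorsion_normal 𝔉.BN _).conj_mem _ (Subgroup.mem_inf.mp hδ₂').1 σ, ?_⟩
    have h2 := (Subgroup.mem_inf.mp hδ₂').2
    rw [h8] at h2 ⊢
    exact Subgroup.mem_inf.mpr ⟨(𝔉.units_normal 𝔉.BN).conj_mem _ h2.1 σ,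
      mul_mem (mul_mem hσn h2.2) (inv_mem hσn)⟩
  · rw [EN_map_psiAut Ψ β α e Dc θ hcap hT hstrv hY hU, hDc, map_mul, mul_smul,
      conj_smul_eq_self_of_mem_normalizer hσn]
  · rw [range_sgpCap_map_psiAut Ψ β α e Dc θ hcap hT hstrv, hDc, map_mul, mul_smul,
      Subgroup.conj_smul_eq_self_of_mem hσr]
  · rw [range_sgpCup_map_psiAut Ψ β α e Dp θ hcup hT' hstrv hYdd]
    congr 2
    calc Dp = Dc * (Dc⁻¹ * Dp) := by group
      _ = δ₁ * σ * (δ₂' * δ₃') := by rw [hDD, hDc]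
      _ = δ₁ * (σ * δ₂' * σ⁻¹) * (σ * δ₃') := by group

end ThetaFrobenioid

end Literature.AnabelianGeometry.EtaleTheta
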